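import Summits.QuantumFields.YangMills.Theorems.UnitScaleTiltHalvingHSiteDatumOfSocketsTGamma
import HarnessLib

/-!
# `hP1room` PROGRAMME — EDITION γ, FILE (γ-3a) v1.1: ★★ THE MEMBER's DATUM FROM THE GUARDED THEOREM-4 SOCKET `hT4Tγ`, WITH J3's TREE ROW (c′) EXPORTED

Route `UnitScaleTilt`, crux K1 child «MinimiserStabilityRegPr» (stmt-QuantumFields-19200), registered stub `stub_halvingStep` (`BirthV10`), display v7γ (✓p686336).
Cell `ym3-torus` (HUMAN RULING D-0037: YM₃ on T³ is ladder rung R3 — NOT d = 4, NOT infinite volume, NOT a mass gap, NOT the Clay problem), width seat `ym-ust-19200-w3`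
gen 10.  `--supports stmt-QuantumFields-19200 --as helper`; THEOREMS ONLY (0 `def`, 0 `sorry`); count-neutral; nothing here claims the displayed socket, the stub, the crux or
the gap.

WHY.  The composers' displayed collar socket `H42topCrossT` ((1.42) on the level-`k` crossing bonds at the knit gauge; ✓p683858 v3.1) is to be DISCHARGED by the (M2′)
programme (ym-ust-20520-w5 g9: ℤᵈ spine + (84)∕(86) dictionary + fat-loop Stokes bound).  Its inhabitant closes the OPEN tree transport `axialT(Ũ♯^{(k)}; y₀ → y_in)` into
loop holonomies through the `tLo`-rooted tree legs of □̃^{(k)}, on which J3's pre-gauge makes the top average EXACTLY `1` — J3 (c′), ✓`P1FlatCorePreGauge.exists_preGauge_flat`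
conjunct 5 [Balaban1985Averaging (21)–(23)].  That row was dropped (`-`) by ✓`exists_preGauge_chart_su` and hence by ✓p679350; this file re-exports it so that the v3.2
composer can hand it to the socket as a FOURTH guard on `gJ` (bus 2026-08-29 01:35:38Z∕01:36:05Z: «(R3) YES — needed INSIDE the socket; not implied by the three guards»).
* §1 ★★ `exists_preGauge_chart_su_tree` — ✓`HalvingP1FlatCoreSupplierPreGaugeMember.exists_preGauge_chart_su` + (c′).
* §2 ★★ `siteDatum_of_T4Tγ_tree` — ✓p679350 `HalvingHSiteDatumOfSocketsTGamma.siteDatum_of_T4Tγ` + (c′) (output conjunct 4; socket `hT4Tγ` VERBATIM).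
HONEST SCOPE.  Bookkeeping twins (one more ∃-component threaded); nothing of Prop. 5, Theorem 4, [4] or the stub is proved here.

References: T. Bałaban, CMP **99** (1985) 75–102 [Balaban1985RegularSpaces] (Thm 4 p.88, Prop. 5 (1.106)–(1.109) p.94, (1.29) p.81, (1.33)–(1.36) p.82, (1.65)–(1.66)
p.87, p.98); CMP **98** (1985) 17–51 [Balaban1985Averaging] ((8) p.18, (19)–(23) pp.20–21); CMP **102** (1985) 277–309 [Balaban1985Variational] ((2) p.278, (152) p.301).
-/

set_option autoImplicit false

noncomputable section

open scoped BigOperators Matrix.Norms.L2Operator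
open NormedSpace
open Complex (I)

namespace Summit.QuantumFields.YangMills.Theorems.HalvingHSiteDatumOfSocketsTGammaTree

open Literature.MathematicalPhysics.QuantumFieldTheory.Balaban1983to89
open Literature.MathematicalPhysics.QuantumFieldTheory.Balaban1983to89.T3ContinuumYM3Torus
open Literature.MathematicalPhysics.QuantumFieldTheory.Balaban1983to89.T3PrintedRegularMinimiser (RegPr regFibrePr mem_regFibrePr_iff)
open MatrixLog (mlog)
open B5Eq118OneStroke (iterBlockOf)
open B7Prop1Explicit (e expUnit l1)
open B7Prop1Explicit renaming Site → LSite
open B7Prop2Explicit (unitaryUnits C0 c2' avgIter)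
open B7Prop3Flat (c3)
open B7Prop1Local (InBox loK bondHiK)
open B7Eq92Concrete (mgauge)
open B8Ineq130 (tlo thi)
open B8Ineq132 (covDerivFwd InAk)
open B8Eq119TwistedAxial (Restr129 InAx)
open B8Eq131Cubes (cube gs tLo tHi)
open B8Eq131CubesAdmissible (cubeFam)
open B8CubeMemberZd (cubeLamS cubeLamB hbox_cubeLamB)
open B8Eq184Proof (gaugeExp cfgExp)
open B8Eq140Level (SideTouches)
open B8Eq146AExpansion (iEta)
open B8Eq138LandauZd (IsLandau138W)
open B7Prop4GeneralLevels (logCovIter linCovIter)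
open B8Eq155JBound (Jcur wsup)
open B8ScaledSupNorm (bondNorm msup)
open B8SpecialUnitaryTrace (trCLM)
open B7Prop2SpecialUnitary (specialUnitaryUnits)
open B10Eq27TorusAxialLog (transl rel pull pull_apply unitsField toUField suIncl gaugeActT unitsField_mem_unitaryUnits)
open B15Eq112TorusCover (lift)
open Summit.QuantumFields.YangMills.Theorems.Prop8ChartDoubleBar (dbarIterU vframeU)
open Summit.QuantumFields.YangMills.Theorems (FlatMinimizerH.le_T3)
open P1FlatCoreCubeInclusion (corner_of_offset room_of_level_k)
open P1FlatCoreFrameLinLipschitz (exists_effGaugeFun)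
open HalvingP1FlatCoreSupplierInductionSU (datum_of_preGauge_cubeMember_SU)
open HalvingP1FlatCoreSupplierDatumTrace (hAτ_of_datum_pull)
open HalvingHSiteDatumOfSockets (member_windows)
open B7Prop2Explicit (avgIter_zero)
open B8Lemma1NonAbelian (lowPart)
open B10Eq27TorusAxialLog (val_unitsField val_suIncl)
open Summit.QuantumFields.YangMills.Theorems.P1FlatCorePreGauge (exists_preGauge_flat preGauge_windows)
open Summit.QuantumFields.YangMills.Theorems.HalvingP1FlatCoreSupplierPreGauge (exists_cutoff_oneForm)

variable (F : T3Family) {n K : ℕ}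

/-! ## §1 J3's chart with the `SU(2)` gauge explicit, tree row kept -/

/-- ★★ **THE PRE-GAUGE CHART WITH THE `SU(2)` GAUGE EXPLICIT AND J3's TREE ROW (c′) KEPT** — ✓`HalvingP1FlatCoreSupplierPreGaugeMember.exists_preGauge_chart_su`
VERBATIM plus ONE more conjunct, placed right after (b′): ✓`P1FlatCorePreGauge.exists_preGauge_flat`'s conjunct 5 «the top average `Ũ♯^{(k)} = avgIter (U′) k` equals `1` on
the `tLo`-rooted tree bonds of □̃^{(k)}» (dropped as `-` in the original).  Proof verbatim (one more component threaded).
[cite: Balaban1985RegularSpaces, (1.33)-(1.36) p.82, (1.65)-(1.66) p.87, Thm 4 p.88; Balaban1985Variational, (2) p.278, (152) p.301; Balaban1985Averaging, (8) p.18, (21)-(23) p.21] -/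
theorem exists_preGauge_chart_su_tree (hnK : n < K) {ε₀ : ℝ} (hε₀ : 0 < ε₀) (hε : 10 ^ 7 * (F.L : ℝ) ^ 3 * ε₀ ≤ 1)
    {U : GaugeField (F.P K) 0 (Matrix.specialUnitaryGroup (Fin 2) ℂ)} (hU : RegPr F n K ε₀ U)
    (a : LSite (F.P K).d) (M' ρ' : ℕ)
    (hwrap : ∀ i, tHi a M' ρ' i - tLo a ρ' i < ((F.P K).sitesPerDir (K - n) : ℤ))
    (hsmall : 11 * ((F.P K).d : ℝ) ^ 2 * (2 * ε₀) + l1 (tHi a M' ρ' - tLo a ρ') * (2 * (2 * ε₀)) ≤ 1 / 6) :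
    ∃ (gJ : GaugeTransf (F.P K) 0 (Matrix.specialUnitaryGroup (Fin 2) ℂ)) (A : LSite (F.P K).d → Fin (F.P K).d → Matrix (Fin 2) (Fin 2) ℂ),
      -- the units bridge
      unitsField (toUField (GaugeField.gaugeAct gJ U)) = gaugeActT (fun x => Unitary.toUnits (suIncl (gJ x))) (unitsField (toUField U)) ∧
      -- J3 (a): `U′ ∈ 𝔄_k(ε₀)`
      InAk (F.P K).L (K - n) (((F.L : ℝ)⁻¹) ^ (K - n)) ε₀ (fun _ => (Set.univ : Set (LSite (F.P K).d)))
        (pull (unitsField (toUField (GaugeField.gaugeAct gJ U))) 0) ∧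
      -- J3 (b′): `U′ ∈ Ax_m(ℭ, 1)`
      (∀ m, m ≤ K - n → ∀ Λ : ℕ → Set (LSite (F.P K).d),
        InAx (F.P K).L m Λ (1 : LSite (F.P K).d → Fin (F.P K).d → (Matrix (Fin 2) (Fin 2) ℂ)ˣ) (pull (unitsField (toUField (GaugeField.gaugeAct gJ U))) 0)) ∧
      -- J3 (c′): the top average is `1` on the tree bonds of □̃^{(k)} (the `tLo`-rooted lexicographic comb; ✓`exists_preGauge_flat` conj. 5)
      (∀ (x : LSite (F.P K).d) (ν : Fin (F.P K).d), tLo a ρ' ≤ x → x + e ν ≤ tHi a M' ρ' → lowPart ν (x - tLo a ρ') = 0 →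
        avgIter (F.P K).L (pull (unitsField (toUField (GaugeField.gaugeAct gJ U))) 0) (K - n) x ν = 1) ∧
      -- J3 (d): (1.66) at background `1` on the whole tower below □̃^{(k)}
      (∀ m, m ≤ K - n → ∀ (x : LSite (F.P K).d) (ν : Fin (F.P K).d), tlo (F.P K).L (tLo a ρ') m ≤ x → x + e ν ≤ thi (F.P K).L (tHi a M' ρ') m →
        ‖((avgIter (F.P K).L (pull (unitsField (toUField (GaugeField.gaugeAct gJ U))) 0) (K - n - m) x ν : (Matrix (Fin 2) (Fin 2) ℂ)ˣ) :
            Matrix (Fin 2) (Fin 2) ℂ) - 1‖ < 11 * ((F.P K).d : ℝ) ^ 2 * (2 * ε₀) + l1 (tHi a M' ρ' - tLo a ρ') * (2 * (2 * ε₀))) ∧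
      -- the cutoff one-form: GLOBAL rows
      (∀ (x : LSite (F.P K).d) (ν : Fin (F.P K).d), IsSelfAdjoint (A x ν)) ∧
      (∀ (x : LSite (F.P K).d) (ν : Fin (F.P K).d), (A x ν).trace = 0) ∧
      (∀ (x : LSite (F.P K).d) (ν : Fin (F.P K).d), ((F.L : ℝ)⁻¹) ^ (K - n) * ‖A x ν‖ ≤ 1 / 2) ∧
      -- on the fine territory of □̃: the chart, the (1.36) size, the near-`1`
      (∀ (x : LSite (F.P K).d) (ν : Fin (F.P K).d), tlo (F.P K).L (tLo a ρ') (K - n) ≤ x → x + e ν ≤ thi (F.P K).L (tHi a M' ρ') (K - n) →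
        pull (unitsField (toUField (GaugeField.gaugeAct gJ U))) 0 x ν = cfgExp (((F.L : ℝ)⁻¹) ^ (K - n)) A x ν ∧
        ((F.L : ℝ)⁻¹) ^ (K - n) * ‖A x ν‖ ≤ 2 * (11 * ((F.P K).d : ℝ) ^ 2 * (2 * ε₀) + l1 (tHi a M' ρ' - tLo a ρ') * (2 * (2 * ε₀))) ∧
        ‖((pull (unitsField (toUField (GaugeField.gaugeAct gJ U))) 0 x ν : (Matrix (Fin 2) (Fin 2) ℂ)ˣ) : Matrix (Fin 2) (Fin 2) ℂ) - 1‖ <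
          11 * ((F.P K).d : ℝ) ^ 2 * (2 * ε₀) + l1 (tHi a M' ρ' - tLo a ρ') * (2 * (2 * ε₀))) := by
  have hL0 : (F.L : ℝ) ≠ 0 := Nat.cast_ne_zero.2 (F.P K).L_pos.ne'
  set η : ℝ := ((F.L : ℝ)⁻¹) ^ (K - n) with hηdef
  have hη : 0 < η := pow_pos (inv_pos.2 (Nat.cast_pos.2 (F.P K).L_pos)) _
  set s₀ : ℝ := 11 * ((F.P K).d : ℝ) ^ 2 * (2 * ε₀) + l1 (tHi a M' ρ' - tLo a ρ') * (2 * (2 * ε₀)) with hs₀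
  have hs₀4 : s₀ ≤ 1 / 4 := hsmall.trans (by norm_num)
  obtain ⟨hε3, hε2, -⟩ := preGauge_windows F (K := K) hε₀.le hε (B := 0) (by norm_num)
  obtain ⟨gJ, hInAk, -, -, hInAx, htree, -, htower⟩ :=
    exists_preGauge_flat F hnK hε₀ hε3 hε2 hU (tLo a ρ') (tHi a M' ρ') hwrap hsmall 1 (Subgroup.one_mem _)
  have hbridge : unitsField (toUField (GaugeField.gaugeAct gJ U)) = gaugeActT (fun x => Unitary.toUnits (suIncl (gJ x))) (unitsField (toUField U)) := by
    rw [T3PrintedRegularOrbits.toUField_gaugeAct, B10Eq68TorusRegularity.unitsField_gaugeAct]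
  set W₁ : GaugeField (F.P K) 0 (Matrix (Fin 2) (Fin 2) ℂ)ˣ := unitsField (toUField (GaugeField.gaugeAct gJ U)) with hW₁
  have hWsu : ∀ b : PBond (F.P K) 0, ((W₁ b : (Matrix (Fin 2) (Fin 2) ℂ)ˣ) : Matrix (Fin 2) (Fin 2) ℂ) ∈ Matrix.specialUnitaryGroup (Fin 2) ℂ := by
    intro b
    rw [hW₁, val_unitsField]
    show ((suIncl (GaugeField.gaugeAct gJ U b) : Matrix.unitaryGroup (Fin 2) ℂ) : Matrix (Fin 2) (Fin 2) ℂ) ∈ _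
    rw [val_suIncl]
    exact (GaugeField.gaugeAct gJ U b).2
  -- the fine territory: (d) at `m = k`
  have hfine : ∀ (x : LSite (F.P K).d) (ν : Fin (F.P K).d), tlo (F.P K).L (tLo a ρ') (K - n) ≤ x → x + e ν ≤ thi (F.P K).L (tHi a M' ρ') (K - n) →
      ‖((W₁ ⟨transl 0 x, ν⟩ : (Matrix (Fin 2) (Fin 2) ℂ)ˣ) : Matrix (Fin 2) (Fin 2) ℂ) - 1‖ < s₀ := by
    intro x ν hx hxν
    have h := htower (K - n) le_rfl x ν hx hxν
    rwa [Nat.sub_self, avgIter_zero, pull_apply] at h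
  obtain ⟨A, hAsa, hAtr, hAhalf, hAnear⟩ := exists_cutoff_oneForm hη W₁ hWsu
  refine ⟨gJ, A, hbridge, hInAk, hInAx, htree, htower, hAsa, hAtr, hAhalf, fun x ν hx hxν => ?_⟩
  have hb := hfine x ν hx hxν
  obtain ⟨hAx, hexp⟩ := hAnear x ν (hb.le.trans hs₀4)
  refine ⟨?_, ?_, ?_⟩
  · rw [pull_apply, hexp]
  · rw [hAx]
    exact HalvingP1FlatCoreSupplierPreGauge.eta_mul_norm_logCfg_pull_le hη W₁ x ν (hs₀4.trans (by norm_num)) hb.le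
  · rw [pull_apply]; exact hb

/-! ## §2 The member's datum from `hT4Tγ`, tree row exported -/

set_option maxHeartbeats 400000 in
/-- ★★ **THE MEMBER's DATUM FROM THE GUARDED SOCKET WITH SUPPORT CLAUSE, TREE ROW EXPORTED (FILE (γ-3a) v1.1)** — ✓p679350 `siteDatum_of_T4Tγ` VERBATIM with ONE more
output conjunct right after J3's three rows: (c′) the top average is `1` on the `tLo a ρ′`-rooted tree bonds of □̃^{(k)} (§1).  Socket `hT4Tγ` unchanged; proof verbatim.
[cite: Balaban1985RegularSpaces, Thm 4 p.88, (1.107) p.94, (1.29) p.81, (1.36) p.82, (1.66) p.87, p.98; Balaban1985Variational, (152) p.301; Balaban1985Averaging, (8) p.18, (20)-(23) pp.20-21] -/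
theorem siteDatum_of_T4Tγ_tree (L : ℕ) (hF : F.L = L) (hnK : n < K) (h2 : 2 ≤ K - n)
    -- `hMember`'s antecedents read at one site: the member, the pre-gauge's smallnesses, the room, the field, the site; the window letter `t` and the corner `a`
    (ρ S M M' : ℕ) {ρ' : ℕ} (hρ'def : ρ' = ρ + M + L + S) {ε₀ : ℝ} (hε₀ : 0 < ε₀) (hε : 10 ^ 7 * (F.L : ℝ) ^ 3 * ε₀ ≤ 1)
    {s : ℝ} (hsdef : s = (198 + 12 * (((M' : ℝ) - 1) + 4 * ρ')) * ε₀) (hs6 : s ≤ 1 / 6)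
    (hroom : 2 * ρ + (M' + 1 + 2 * (M + L + S)) ≤ F.L ^ (F.m + n))
    (V : GaugeField (F.P n) 0 (Matrix.specialUnitaryGroup (Fin 2) ℂ)) (U : GaugeField (F.P K) 0 (Matrix.specialUnitaryGroup (Fin 2) ℂ))
    (hU : U ∈ regFibrePr F n K hnK.le ε₀ V) (x₀ : Site (F.P K) 0)
    {t : ℤ} (ht0 : 0 ≤ t) (ht : t ≤ (M' : ℤ) - 1) {a : LSite (F.P K).d} (hadef : a = fun μ => ((iterBlockOf (K - n) x₀ μ).val : ℤ) - t)
    -- Theorem 4's size constant `c⋆` (★t4-w13's letter `cstar`) and the one window the trace row needs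
    {cstar : ℝ} (hcs16 : cstar ≤ 1 / 16)
    -- SOCKET `hT4Tγ`: Theorem 4's datum WITH ITS SUPPORT CLAUSE at every level `m ≤ K − n` for `U′ := pull (U^{gJ})♯ 0`, ∀-closed over the member's `SU(2)` gauge with J3's FOUR rows
    -- as antecedents — (1.34)-𝔄, axial (b′), the tower row (d) (`< s`, exported for ✓`H42_of_inAx`), the fine near-`1` `< s` on □̃ (the CONCLUSION of (τ-D) ✓p654692; §2)
    (hT4Tγ : ∀ gJ : GaugeTransf (F.P K) 0 (Matrix.specialUnitaryGroup (Fin 2) ℂ),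
      InAk (F.P K).L (K - n) (((F.L : ℝ)⁻¹) ^ (K - n)) ε₀ (fun _ => (Set.univ : Set (LSite (F.P K).d))) (pull (unitsField (toUField (GaugeField.gaugeAct gJ U))) 0) →
      (∀ m', m' ≤ K - n → ∀ Λ : ℕ → Set (LSite (F.P K).d),
        InAx (F.P K).L m' Λ (1 : LSite (F.P K).d → Fin (F.P K).d → (Matrix (Fin 2) (Fin 2) ℂ)ˣ) (pull (unitsField (toUField (GaugeField.gaugeAct gJ U))) 0)) →
      (∀ m', m' ≤ K - n → ∀ (x : LSite (F.P K).d) (ν : Fin (F.P K).d), tlo (F.P K).L (tLo a ρ') m' ≤ x → x + e ν ≤ thi (F.P K).L (tHi a M' ρ') m' →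
        ‖((avgIter (F.P K).L (pull (unitsField (toUField (GaugeField.gaugeAct gJ U))) 0) (K - n - m') x ν : (Matrix (Fin 2) (Fin 2) ℂ)ˣ) :
            Matrix (Fin 2) (Fin 2) ℂ) - 1‖ < s) →
      (∀ (x : LSite (F.P K).d) (ν : Fin (F.P K).d), tlo (F.P K).L (tLo a ρ') (K - n) ≤ x → x + e ν ≤ thi (F.P K).L (tHi a M' ρ') (K - n) →
        ‖((pull (unitsField (toUField (GaugeField.gaugeAct gJ U))) 0 x ν : (Matrix (Fin 2) (Fin 2) ℂ)ˣ) : Matrix (Fin 2) (Fin 2) ℂ) - 1‖ < s) →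
      ∀ m, m ≤ K - n → ∃ u : LSite (F.P K).d → (Matrix (Fin 2) (Fin 2) ℂ)ˣ,
        (∀ x, ((u x : (Matrix (Fin 2) (Fin 2) ℂ)ˣ) : Matrix (Fin 2) (Fin 2) ℂ) ∈ Matrix.specialUnitaryGroup (Fin 2) ℂ) ∧
        (∀ x, x ∉ cubeFam false (F.P K).L a M' ρ' (K - n) 0 → u x = 1) ∧
        Restr129 (F.P K).L m (cubeLamS (F.P K).L a M' ρ' (K - n) m) (1 : LSite (F.P K).d → Fin (F.P K).d → (Matrix (Fin 2) (Fin 2) ℂ)ˣ) u ∧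
        ∃ W : LSite (F.P K).d → Fin (F.P K).d → (Matrix (Fin 2) (Fin 2) ℂ)ˣ,
          mgauge (1 : LSite (F.P K).d → Fin (F.P K).d → (Matrix (Fin 2) (Fin 2) ℂ)ˣ) u W = pull (unitsField (toUField (GaugeField.gaugeAct gJ U))) 0 ∧
          (1 ≤ m → IsLandau138W (F.P K).L m (((F.L : ℝ)⁻¹) ^ (K - n)) (cubeFam false (F.P K).L a M' ρ' (K - n) 0) (cubeLamS (F.P K).L a M' ρ' (K - n) m)
            (1 : LSite (F.P K).d → Fin (F.P K).d → (Matrix (Fin 2) (Fin 2) ℂ)ˣ) W) ∧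
          ∃ A : LSite (F.P K).d → Fin (F.P K).d → Matrix (Fin 2) (Fin 2) ℂ, ∀ j, j ≤ m →
            ∀ b ∈ {b : LSite (F.P K).d × Fin (F.P K).d | SideTouches (cubeFam false (F.P K).L a M' ρ' (K - n) j) b.1 b.2},
              W b.1 b.2 = cfgExp (((F.L : ℝ)⁻¹) ^ (K - n)) A b.1 b.2 ∧ IsSelfAdjoint (A b.1 b.2) ∧
                ‖A b.1 b.2‖ ≤ cstar * (((F.P K).L : ℝ) ^ j * ((F.L : ℝ)⁻¹) ^ (K - n))⁻¹) :
    ∃ (gJ : GaugeTransf (F.P K) 0 (Matrix.specialUnitaryGroup (Fin 2) ℂ)) (u₁ : LSite (F.P K).d → (Matrix (Fin 2) (Fin 2) ℂ)ˣ)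
      (W : LSite (F.P K).d → Fin (F.P K).d → (Matrix (Fin 2) (Fin 2) ℂ)ˣ) (A : LSite (F.P K).d → Fin (F.P K).d → Matrix (Fin 2) (Fin 2) ℂ)
      (κf : (Site (F.P K) 0 → Matrix (Fin 2) (Fin 2) ℂ) → (i : ℕ) → GaugeTransf (F.P K) i (Matrix (Fin 2) (Fin 2) ℂ)ˣ),
      -- J3's rows for `U′`: (1.34)-𝔄 on `ℤᵈ`, axial at the flat background for every family, (1.66) on the whole tower below □̃
      InAk (F.P K).L (K - n) (((F.L : ℝ)⁻¹) ^ (K - n)) ε₀ (fun _ => (Set.univ : Set (LSite (F.P K).d))) (pull (unitsField (toUField (GaugeField.gaugeAct gJ U))) 0) ∧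
      (∀ m', m' ≤ K - n → ∀ Λ : ℕ → Set (LSite (F.P K).d),
        InAx (F.P K).L m' Λ (1 : LSite (F.P K).d → Fin (F.P K).d → (Matrix (Fin 2) (Fin 2) ℂ)ˣ) (pull (unitsField (toUField (GaugeField.gaugeAct gJ U))) 0)) ∧
      (∀ m', m' ≤ K - n → ∀ (x : LSite (F.P K).d) (ν : Fin (F.P K).d), tlo (F.P K).L (tLo a ρ') m' ≤ x → x + e ν ≤ thi (F.P K).L (tHi a M' ρ') m' →
        ‖((avgIter (F.P K).L (pull (unitsField (toUField (GaugeField.gaugeAct gJ U))) 0) (K - n - m') x ν : (Matrix (Fin 2) (Fin 2) ℂ)ˣ) :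
            Matrix (Fin 2) (Fin 2) ℂ) - 1‖ < s) ∧
      -- J3 (c′) (v1.1): the top average `Ũ♯^{(k)}` is `1` on the `tLo a ρ′`-rooted tree bonds of □̃^{(k)} — the FOURTH guard of the composers' collar socket `H42topCrossT` (R3)
      (∀ (x : LSite (F.P K).d) (ν : Fin (F.P K).d), tLo a ρ' ≤ x → x + e ν ≤ tHi a M' ρ' → lowPart ν (x - tLo a ρ') = 0 →
        avgIter (F.P K).L (pull (unitsField (toUField (GaugeField.gaugeAct gJ U))) 0) (K - n) x ν = 1) ∧
      -- Theorem 4's datum rows at level `K − n − 1`: `u₁` special unitary, SUPPORTED IN `□₀`, (1.29), `W^{u₁} = U′`, Landau (1.38), chart-with-size (1.36) on the touched sides, trace row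
      (∀ z, ((u₁ z : (Matrix (Fin 2) (Fin 2) ℂ)ˣ) : Matrix (Fin 2) (Fin 2) ℂ) ∈ Matrix.specialUnitaryGroup (Fin 2) ℂ) ∧
      (∀ x, x ∉ cubeFam false (F.P K).L a M' ρ' (K - n) 0 → u₁ x = 1) ∧
      Restr129 (F.P K).L (K - n - 1) (cubeLamS (F.P K).L a M' ρ' (K - n) (K - n - 1)) (1 : LSite (F.P K).d → Fin (F.P K).d → (Matrix (Fin 2) (Fin 2) ℂ)ˣ) u₁ ∧
      mgauge (1 : LSite (F.P K).d → Fin (F.P K).d → (Matrix (Fin 2) (Fin 2) ℂ)ˣ) u₁ W = pull (unitsField (toUField (GaugeField.gaugeAct gJ U))) 0 ∧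
      IsLandau138W (F.P K).L (K - n - 1) (((F.L : ℝ)⁻¹) ^ (K - n)) (cubeFam false (F.P K).L a M' ρ' (K - n) 0) (cubeLamS (F.P K).L a M' ρ' (K - n) (K - n - 1))
        (1 : LSite (F.P K).d → Fin (F.P K).d → (Matrix (Fin 2) (Fin 2) ℂ)ˣ) W ∧
      (∀ j, j ≤ K - n - 1 → ∀ b ∈ {b : LSite (F.P K).d × Fin (F.P K).d | SideTouches (cubeFam false (F.P K).L a M' ρ' (K - n) j) b.1 b.2},
        W b.1 b.2 = cfgExp (((F.L : ℝ)⁻¹) ^ (K - n)) A b.1 b.2 ∧ IsSelfAdjoint (A b.1 b.2) ∧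
          ‖A b.1 b.2‖ ≤ cstar * (((F.P K).L : ℝ) ^ j * ((F.L : ℝ)⁻¹) ^ (K - n))⁻¹) ∧
      (∀ j, j ≤ K - n - 1 → ∀ b ∈ {b : LSite (F.P K).d × Fin (F.P K).d | SideTouches (cubeFam false (F.P K).L a M' ρ' (K - n) j) b.1 b.2},
        trCLM (Fin 2) (A b.1 b.2) = 0) ∧
      -- F3's tower of the charted iterate at the composite gauge `(u₁ ∘ rep)⁻¹·ĝJ`
      (∀ (m : Site (F.P K) 0 → Matrix (Fin 2) (Fin 2) ℂ) (i : ℕ) (y : Site (F.P K) (i + 1)),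
        κf m (i + 1) y = (vframeU (gaugeActT (κf m i) (dbarIterU i (gaugeActT
          (fun s => (u₁ (lift (F.P K) x₀ + rel x₀ s))⁻¹ * Unitary.toUnits (suIncl (gJ s)) : GaugeTransf (F.P K) 0 (Matrix (Fin 2) (Fin 2) ℂ)ˣ)
          (unitsField (toUField U))))) y)⁻¹ * κf m i (emb y) *
          vframeU (dbarIterU i (gaugeActT
            (fun s => (u₁ (lift (F.P K) x₀ + rel x₀ s))⁻¹ * Unitary.toUnits (suIncl (gJ s)) : GaugeTransf (F.P K) 0 (Matrix (Fin 2) (Fin 2) ℂ)ˣ)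
            (unitsField (toUField U)))) y) ∧
      (∀ (m : Site (F.P K) 0 → Matrix (Fin 2) (Fin 2) ℂ) (x : Site (F.P K) 0), ((κf m 0 x : (Matrix (Fin 2) (Fin 2) ℂ)ˣ) : Matrix (Fin 2) (Fin 2) ℂ) = exp (m x)) := by
  classical
  subst hadef hρ'def
  have hL2 : 2 ≤ (F.P K).L := (F.P K).hL.2
  have hL1 : 1 ≤ (F.P K).L := le_trans (by norm_num) hL2
  have hη : 0 < ((F.L : ℝ)⁻¹) ^ (K - n) := by
    have hL0 : (0 : ℝ) < F.L := by exact_mod_cast (F.P K).L_pos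
    positivity
  have hUreg : RegPr F n K ε₀ U := ((mem_regFibrePr_iff F).1 hU).2
  obtain ⟨-, hwrap, hsJ⟩ := member_windows F L hF hnK ρ S M M' (ε₀ := ε₀) hroom x₀ ht0 ht
  have hsmallJ : 11 * ((F.P K).d : ℝ) ^ 2 * (2 * ε₀) +
      l1 (tHi (fun μ => ((iterBlockOf (K - n) x₀ μ).val : ℤ) - t) M' (ρ + M + L + S) -
        tLo (fun μ => ((iterBlockOf (K - n) x₀ μ).val : ℤ) - t) (ρ + M + L + S)) * (2 * (2 * ε₀)) ≤ 1 / 6 := by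
    rw [hsJ, ← hsdef]; exact hs6
  -- J3 at the member with the SU(2) gauge explicit (✓`exists_preGauge_chart_su`)
  obtain ⟨gJ, A₀, -, hInAk, hInAx, htree, htower, -, -, -, hterr⟩ :=
    exists_preGauge_chart_su_tree F hnK hε₀ hε hUreg (fun μ => ((iterBlockOf (K - n) x₀ μ).val : ℤ) - t) M' (ρ + M + L + S) hwrap hsmallJ
  rw [hsJ, ← hsdef] at hterr htower
  have hfine : ∀ (x : LSite (F.P K).d) (ν : Fin (F.P K).d),
      tlo (F.P K).L (tLo (fun μ => ((iterBlockOf (K - n) x₀ μ).val : ℤ) - t) (ρ + M + L + S)) (K - n) ≤ x →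
      x + e ν ≤ thi (F.P K).L (tHi (fun μ => ((iterBlockOf (K - n) x₀ μ).val : ℤ) - t) M' (ρ + M + L + S)) (K - n) →
      ‖((pull (unitsField (toUField (GaugeField.gaugeAct gJ U))) 0 x ν : (Matrix (Fin 2) (Fin 2) ℂ)ˣ) : Matrix (Fin 2) (Fin 2) ℂ) - 1‖ < s :=
    fun x ν h1 h2 => (hterr x ν h1 h2).2.2
  -- Theorem 4's datum at level `K − n − 1` (the socket)
  obtain ⟨u₁, hu₁SU, hu₁S, h129, W, hW, hLan, A, hdat⟩ := hT4Tγ gJ hInAk hInAx htower hfine (K - n - 1) (Nat.sub_le _ _)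
  have hLan' := hLan (by omega)
  -- the trace row (✓p657841)
  have hAτ := hAτ_of_datum_pull (GaugeField.gaugeAct gJ U) 0 hη hL1
    (cubeFam false (F.P K).L (fun μ => ((iterBlockOf (K - n) x₀ μ).val : ℤ) - t) M' (ρ + M + L + S) (K - n)) hu₁SU hW hcs16 hdat
  -- F3's effective-gauge tower at the composite gauge
  obtain ⟨κf, hκfs, hκf0, -⟩ := exists_effGaugeFun (P := F.P K) (gaugeActT
    (fun s => (u₁ (lift (F.P K) x₀ + rel x₀ s))⁻¹ * Unitary.toUnits (suIncl (gJ s)) : GaugeTransf (F.P K) 0 (Matrix (Fin 2) (Fin 2) ℂ)ˣ)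
    (unitsField (toUField U)))
  exact ⟨gJ, u₁, W, A, κf, hInAk, hInAx, htower, htree, hu₁SU, hu₁S, h129, hW, hLan', hdat, hAτ, hκfs, hκf0⟩

end Summit.QuantumFields.YangMills.Theorems.HalvingHSiteDatumOfSocketsTGammaTree

end
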